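import Summits.FinalStateConjecture.FinalStateConjecture.Theses.StarvedNecks
import Summits.FinalStateConjecture.FinalStateConjecture.Theorems.SwallowTheDatumParametricKerrBurialLine
import Summits.FinalStateConjecture.FinalStateConjecture.Theorems.StarvedNecksHonestFixedRadiusSettlingStubProbePatch
import Summits.FinalStateConjecture.FinalStateConjecture.Theorems.StarvedNecksHonestFixedRadiusSettlingStubThresholdJunction
import Summits.FinalStateConjecture.FinalStateConjecture.Theorems.HonestFixedRadiusSettling.Negative.CoreLoadBearing

/-!
# Route StarvedNecks — crux `HonestFixedRadiusSettling` (stmt-FinalStateConjecture-13550), line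
# `far-field-surgery`: vocabulary and the REDUCTION of the crux to its two remaining atoms

Definitions-plus-glue support file of the line `far-field-surgery` (lead c1), so that the registered
stubs of the skeleton `Cruxes/HonestFixedRadiusSettling/Lines/far_field_surgery.lean` (not importable)
and the tree speak about the SAME declarations, and so that the reduction achieved by the line is a
theorem of the tree.  Nothing open is asserted: the two remaining stubs enter as HYPOTHESES of the
reduction theorem, written out over the vocabulary below.

* §0 VOCABULARY (verbatim from the skeleton): `sobDev` (Mao–Oh–Tao's rescaled `H² × H¹` annulus
  deviation at `s = 2`), `IsInteriorProbe` (compactly supported admissible deformation `t ↦ E t` of the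
  datum, `E 0 = d`), `IsFarGluingFamily` (radius-indexed remote gluing `R ↦ G R` onto an exact
  time-symmetric Schwarzschild end of mass `m R ↓ M₀`), `IsRemoteSurgery` (the surgery 2-family
  `S (R, t)` over the probe).  The one-atlas property is NOT restated: it is the disprover's
  `Negative.coreSet X` (`CoreLoadBearing.lean`, p116296) — the crux's pointwise property with the `𝓘⁺`
  clause REPLACED by one atlas at infinity (verbatim the seventeen hypotheses of CERT), with
  `Negative.coreSet_subset_settlingSet` (CERT closes the `𝓘⁺` conjunct).
* §1 GLUE (sorry-free): the LANDED patching engine `stub_probePatch` (p116096) yields a remote surgery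
  over any probe and far-gluing family (`exists_isRemoteSurgery`; the `t`-independence, the mass, the
  exact zone and the `sobDev` smallness are read on `e.far R₀`, where `S (R, t) = G R`:
  `isRemoteSurgery_of_patch`, `sobDev_congr_of_agree_far`).
* §2 THE REDUCTION `honestFixedRadiusSettling_of_surgery`: the crux follows from
  (A) FAR GLUING — every admissible datum admits, along every sole Dafermos–Rodnianski end and beyond
  every radius, a far-gluing family (the parametric Mao–Oh–Tao atom: arXiv:2308.13031 Thm 1.7/1.10 at
  scale `R`, printed modulo the `C^∞`-dependence on `R`, which any curve-genericity witness through a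
  non-explicit datum needs), and
  (D′) STABLE UNFOLDING WITH ONE ATLAS — through every admissible datum an interior probe along which,
  after sufficiently remote surgery (`R ≥ ρ t`, `ρ` continuous on `t ≠ 0`), every member has an MGHD
  and every MGHD an honest `C⁴` fixed-radius decomposition of its self-determined exterior with one
  atlas at infinity, i.e. lies in `Negative.coreSet` (the final-state core on Schwarzschild-ended data;
  open problem) —
  via the LANDED threshold-junction lemma `stub_thresholdJunction` (p116598), the glue of §1 and the
  monotonicity of Christodoulou genericity in the property (`Negative.crux_iff`).  Together with
  `OneOverDelta.honestFixedRadiusSettling_of_core` (the sibling line's reduction, p111091) this records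
  in the tree that the crux is EXACTLY "parametric far-field gluing + the final-state core on
  Kerr- or Schwarzschild-ended one-atlas data"; weak cosmic censorship is not a separate clause of either.

References: line card `Cruxes/HonestFixedRadiusSettling/Lines/far-field-surgery.md`; Mao–Oh–Tao
arXiv:2308.13031 (Def 1.5, Thm 1.7, Rem 1.9); Corvino–Schoen, J. Diff. Geom. 73 (2006); Christodoulou,
CQG 16 (1999) A23, p. A24; Dafermos–Luk arXiv:1710.01722, Conjecture 1.
-/

-- the doubled `FinalStateConjecture` path component is the summit/problem naming scheme, not a mistake
set_option linter.dupNamespace false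

noncomputable section

namespace Summit.FinalStateConjecture.FinalStateConjecture.Theorems.StarvedNecks.FarFieldSurgery

open scoped Manifold ContDiff Topology ENNReal
open MeasureTheory Set Filter Function Literature.Geometry.Lorentzian
open Summit.FinalStateConjecture.FinalStateConjecture.Theorems.SwallowTheDatum.ParametricKerrBurial
  (SmoothSectionsOn AgreeAt IsExactSchwarzschildBeyond)
open Summit.FinalStateConjecture.FinalStateConjecture.Theorems.HonestFixedRadiusSettling.Negative
  (settlingSet coreSet coreSet_subset_settlingSet)
open Summit.FinalStateConjecture.FinalStateConjecture.Theses.StarvedNecks (HonestFixedRadiusSettling)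

/-! ## §0 Vocabulary -/

section Surgery

variable {X : Type} [TopologicalSpace X] [ChartedSpace E3 X] [IsManifold (𝓡 3) ∞ X]

/-- **Rescaled `H² × H¹` deviation of `G` from `D` on the dyadic chart annulus `A_λ = {λ < ‖x‖ < 2λ}`
of the end `e`** — the squared norm of Mao–Oh–Tao's Definition 1.5 at `s = 2` applied to the
difference of the chart components: `‖δh(λ·)‖²_{H²(A₁)} + ‖λ·δk(λ·)‖²_{H¹(A₁)}` written at scale `λ`
(`δh = hCoeff e G − hCoeff e D`, `δk = kCoeff e G − kCoeff e D`; data rescale as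
`(h(λy), λ k(λy))`, whence the weights `λ^{2m−3}` on `∂ᵐδh` and `λ^{2m−1}` on `∂ᵐδk`). This is the
subcritical (`s = 2 > 3/2`) smallness in which MOT Thm 1.7 concludes, and small data in it are
perturbative at their own scale. Mao–Oh–Tao arXiv:2308.13031, Def 1.5 and (1.22). [cite: MaoOhTao2023, Def 1.5] -/
def sobDev (e : AFEnd X) (G D : InitialDataSet (𝓡 3) X) (lam : ℝ) : ℝ :=
  let A : Set E3 := {x | lam < ‖x‖ ∧ ‖x‖ < 2 * lam}
  let dh : E3 → E3 →L[ℝ] E3 →L[ℝ] ℝ := fun x ↦ AFEnd.hCoeff e G x - AFEnd.hCoeff e D x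
  let dk : E3 → E3 →L[ℝ] E3 →L[ℝ] ℝ := fun x ↦ AFEnd.kCoeff e G x - AFEnd.kCoeff e D x
  lam ^ (-3 : ℤ) * (∫ x in A, ‖iteratedFDeriv ℝ 0 dh x‖ ^ 2) +
    lam ^ (-1 : ℤ) * (∫ x in A, ‖iteratedFDeriv ℝ 1 dh x‖ ^ 2) +
    lam * (∫ x in A, ‖iteratedFDeriv ℝ 2 dh x‖ ^ 2) +
    lam ^ (-1 : ℤ) * (∫ x in A, ‖iteratedFDeriv ℝ 0 dk x‖ ^ 2) +
    lam * (∫ x in A, ‖iteratedFDeriv ℝ 1 dk x‖ ^ 2)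

/-- **Interior probe** through `d` with support radius `R₀` (in the chart of the end `e`): a family
`t ↦ E t` of ADMISSIBLE data on `X`, jointly smooth on `ℝ × X`, with `E 0 = d`, all of whose members
coincide with `d` (as sections) on the far region `e.far R₀` — a compactly supported admissible
deformation of `d` (Corvino-type local deformation, or the pull-back of `d` by a breathing family of
compactly supported diffeomorphisms). No dynamics is asserted here. [folklore] -/
def IsInteriorProbe (d : InitialDataSet (𝓡 3) X) (e : AFEnd X) (R₀ : ℝ)
    (E : ℝ → InitialDataSet (𝓡 3) X) : Prop :=
  e.R < R₀ ∧ SmoothSectionsOn 𝓘(ℝ, ℝ) E (Set.univ : Set (ℝ × X)) ∧ E 0 = d ∧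
    (∀ t : ℝ, E t ∈ admissibleVacuumData X) ∧ (∀ t : ℝ, ∀ x ∈ e.far R₀, AgreeAt (E t) d x)

/-- **Remote far-gluing family of `d` along the end `e`** (output of stub A): for every radius
`R > R⋆ > R₀` an admissible datum `G R`, jointly smooth in `(R, x)` on `{R⋆ < R} × X`, equal to `d` off
`e.far R`, EXACTLY time-symmetric isotropic Schwarzschild(`m R`) in the chart of `e` beyond `32 R`, with
end masses `m R > M₀`, `m R → M₀` (the DR mass parameter = ADM energy of `d`; the jump `m R − M₀ > 0` is
MOT's positivity `ΔE > |ΔP|`, by construction, no positive-mass theorem) and with the rescaled `H² × H¹`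
deviation from `d` on every dyadic annulus beyond `R` tending to `0` as `R → ∞` (the conclusion (1.22)
of MOT Thm 1.7 at scale `R`; beyond `32R` it is the deviation of `d` from its own Schwarzschild
asymptotics plus `|m R − M₀|`). Mao–Oh–Tao arXiv:2308.13031 Thm 1.7/1.10; Corvino–Schoen,
J. Diff. Geom. 73 (2006), Thm 1. [cite: MaoOhTao2023, Thm 1.7] -/
def IsFarGluingFamily (d : InitialDataSet (𝓡 3) X) (e : AFEnd X) (M₀ R₀ Rstar : ℝ) (m : ℝ → ℝ)
    (G : ℝ → InitialDataSet (𝓡 3) X) : Prop :=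
  R₀ < Rstar ∧ SmoothSectionsOn 𝓘(ℝ, ℝ) G {p : ℝ × X | Rstar < p.1} ∧ Tendsto m atTop (𝓝 M₀) ∧
    (∀ R : ℝ, Rstar < R → G R ∈ admissibleVacuumData X ∧ (∀ x ∉ e.far R, AgreeAt (G R) d x) ∧
      M₀ < m R ∧ IsExactSchwarzschildBeyond e (G R) (m R) (32 * R)) ∧
    (∀ ε : ℝ, 0 < ε → ∃ R₁ : ℝ, ∀ R lam : ℝ, Rstar < R → R₁ ≤ R → R ≤ lam → sobDev e (G R) d lam ≤ ε)

/-- **Remote surgery 2-family over the probe `E`** (output of stub B, input of stubs C and D): for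
`R > R⋆ > R₀` and `t ∈ ℝ` an admissible datum `S (R, t)`, jointly smooth in `((R, t), x)` on
`{R⋆ < R} × ℝ × X`, equal to `E t` off `e.far R` (so equal to the probe inside the gluing radius and to
`d` on `e.far R₀ ∖ e.far R`), independent of `t` on `e.far R₀` (the gluing reads only `d`: surgery and
interior deformation commute), exactly Schwarzschild(`m R`) beyond `32 R` in the chart of `e`,
`m R > M₀`, `m R → M₀`, and rescaled-`H² × H¹`-close to `d` on dyadic annuli beyond `R`, uniformly in `t`, as
`R → ∞`. Every member is therefore SCHWARZSCHILD-ENDED: smooth and conormal at infinity, free of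
incoming radiation beyond the outgoing cone of `{R ≤ ‖x‖ ≤ 64R}`. [folklore] -/
def IsRemoteSurgery (d : InitialDataSet (𝓡 3) X) (e : AFEnd X) (M₀ R₀ : ℝ)
    (E : ℝ → InitialDataSet (𝓡 3) X) (Rstar : ℝ) (m : ℝ → ℝ)
    (S : ℝ × ℝ → InitialDataSet (𝓡 3) X) : Prop :=
  R₀ < Rstar ∧ SmoothSectionsOn (𝓘(ℝ, ℝ).prod 𝓘(ℝ, ℝ)) S {p : (ℝ × ℝ) × X | Rstar < p.1.1} ∧
    Tendsto m atTop (𝓝 M₀) ∧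
    (∀ R t : ℝ, Rstar < R →
      S (R, t) ∈ admissibleVacuumData X ∧ (∀ x ∉ e.far R, AgreeAt (S (R, t)) (E t) x) ∧
        (∀ t' : ℝ, ∀ x ∈ e.far R₀, AgreeAt (S (R, t)) (S (R, t')) x) ∧
        M₀ < m R ∧ IsExactSchwarzschildBeyond e (S (R, t)) (m R) (32 * R)) ∧
    (∀ ε : ℝ, 0 < ε → ∃ R₁ : ℝ, ∀ R t lam : ℝ, Rstar < R → R₁ ≤ R → R ≤ lam →
      sobDev e (S (R, t)) d lam ≤ ε)

omit [IsManifold (𝓡 3) ∞ X] in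
/-- Bookkeeping: a point off `e.far R₀` is off `e.far R⋆` once `R₀ ≤ R⋆` (`AFEnd.far_mono`). [folklore] -/
theorem not_mem_far_of_le (e : AFEnd X) {R₀ Rstar : ℝ} (h : R₀ ≤ Rstar) {x : X}
    (hx : x ∉ e.far R₀) : x ∉ e.far Rstar :=
  fun hx' ↦ hx (e.far_mono h hx')

end Surgery

/-! ## §1 Glue -/

section PatchGlue

variable {X : Type} [TopologicalSpace X] [ChartedSpace E3 X] [IsManifold (𝓡 3) ∞ X]
/-- The end components `hCoeff`, `kCoeff` of two data agree at a chart point beyond radius `R₀`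
(`R₀ > e.R`) as soon as the data agree (as sections) on `e.far R₀`: the components at `x` are the
pullbacks of the sections at the single point `e.dataChart x ∈ e.far R₀`. [folklore] -/
theorem hCoeff_kCoeff_congr_of_agree_far (e : AFEnd X) {D D' : InitialDataSet (𝓡 3) X} {R₀ : ℝ}
    (hR₀ : e.R < R₀) (h : ∀ x ∈ e.far R₀, AgreeAt D D' x) {x : E3} (hx : R₀ < ‖x‖) :
    AFEnd.hCoeff e D x = AFEnd.hCoeff e D' x ∧ AFEnd.kCoeff e D x = AFEnd.kCoeff e D' x := by
  have hxR : e.R < ‖x‖ := hR₀.trans hx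
  have hmem : e.dataChart ⟨x, hxR⟩ ∈ e.far R₀ :=
    ⟨e.chart.symm ⟨x, hxR⟩, by simpa using hx, rfl⟩
  obtain ⟨hh, hk⟩ := h _ hmem
  constructor
  · rw [AFEnd.hCoeff_of_lt D hxR, AFEnd.hCoeff_of_lt D' hxR]
    ext v w
    simp only [pullbackBilin_apply, hh]
  · rw [AFEnd.kCoeff_of_lt D hxR, AFEnd.kCoeff_of_lt D' hxR]
    ext v w
    simp only [pullbackBilin_apply, hk]

/-- `sobDev` is read on `e.far R₀`: if `S` and `G` agree there (`R₀ > e.R`) then for every scale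
`lam ≥ R₀` their rescaled annulus deviations from `d` coincide (the integrands are iterated
derivatives of functions agreeing on the open set `{R₀ < ‖x‖} ⊇ A_lam`). [folklore] -/
theorem sobDev_congr_of_agree_far (e : AFEnd X) {S G d : InitialDataSet (𝓡 3) X} {R₀ lam : ℝ}
    (hR₀ : e.R < R₀) (h : ∀ x ∈ e.far R₀, AgreeAt S G x) (hlam : R₀ ≤ lam) :
    sobDev e S d lam = sobDev e G d lam := by
  -- the two difference fields agree on the open set `{R₀ < ‖x‖}`
  have hopen : IsOpen {x : E3 | R₀ < ‖x‖} := isOpen_lt continuous_const continuous_norm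
  have hEqH : Set.EqOn (fun x ↦ AFEnd.hCoeff e S x - AFEnd.hCoeff e d x)
      (fun x ↦ AFEnd.hCoeff e G x - AFEnd.hCoeff e d x) {x : E3 | R₀ < ‖x‖} := fun x hx ↦ by
    simp only [(hCoeff_kCoeff_congr_of_agree_far e hR₀ h hx).1]
  have hEqK : Set.EqOn (fun x ↦ AFEnd.kCoeff e S x - AFEnd.kCoeff e d x)
      (fun x ↦ AFEnd.kCoeff e G x - AFEnd.kCoeff e d x) {x : E3 | R₀ < ‖x‖} := fun x hx ↦ by
    simp only [(hCoeff_kCoeff_congr_of_agree_far e hR₀ h hx).2]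
  have hA : ∀ x ∈ ({x : E3 | lam < ‖x‖ ∧ ‖x‖ < 2 * lam} : Set E3), x ∈ {x : E3 | R₀ < ‖x‖} :=
    fun x hx ↦ lt_of_le_of_lt hlam hx.1
  have key : ∀ (n : ℕ) (f g : E3 → E3 →L[ℝ] E3 →L[ℝ] ℝ), Set.EqOn f g {x : E3 | R₀ < ‖x‖} →
      ∫ x in {x : E3 | lam < ‖x‖ ∧ ‖x‖ < 2 * lam}, ‖iteratedFDeriv ℝ n f x‖ ^ 2 =
        ∫ x in {x : E3 | lam < ‖x‖ ∧ ‖x‖ < 2 * lam}, ‖iteratedFDeriv ℝ n g x‖ ^ 2 := by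
    intro n f g hfg
    refine MeasureTheory.setIntegral_congr_fun ?_ fun x hx ↦ ?_
    · exact (isOpen_lt continuous_const continuous_norm).inter
        (isOpen_lt continuous_norm (continuous_const)) |>.measurableSet
    · have hx' : x ∈ {x : E3 | R₀ < ‖x‖} := hA x hx
      have hev : f =ᶠ[𝓝 x] g := Filter.eventuallyEq_of_mem (hopen.mem_nhds hx') hfg
      rw [hev.iteratedFDeriv ℝ n |>.eq_of_nhds]
  simp only [sobDev, key _ _ _ hEqH, key _ _ _ hEqK]

/-- **Glue B (reshape v2).** The patching engine's pointwise output IS a remote surgery over the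
probe: every clause of `IsRemoteSurgery` is read either off `e.far R` (where `S = E t`) or on
`e.far R₀` (where `S = G R`). [folklore] -/
theorem isRemoteSurgery_of_patch {d : InitialDataSet (𝓡 3) X} {e : AFEnd X} {M₀ R₀ Rstar : ℝ}
    {E : ℝ → InitialDataSet (𝓡 3) X} {m : ℝ → ℝ} {G : ℝ → InitialDataSet (𝓡 3) X}
    {S : ℝ × ℝ → InitialDataSet (𝓡 3) X}
    (hprobe : IsInteriorProbe d e R₀ E) (hG : IsFarGluingFamily d e M₀ R₀ Rstar m G)
    (hSsmooth : SmoothSectionsOn (𝓘(ℝ, ℝ).prod 𝓘(ℝ, ℝ)) S {p : (ℝ × ℝ) × X | Rstar < p.1.1})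
    (hS : ∀ R t : ℝ, Rstar < R →
      S (R, t) ∈ admissibleVacuumData X ∧
      (∀ x ∉ e.far R, AgreeAt (S (R, t)) (E t) x) ∧
      (∀ x ∈ e.far R₀, AgreeAt (S (R, t)) (G R) x)) :
    IsRemoteSurgery d e M₀ R₀ E Rstar m S := by
  obtain ⟨hR₀, -, -, -, -⟩ := hprobe
  obtain ⟨hR₀star, -, hm, hGmem, hsob⟩ := hG
  have heR₀ : e.R < R₀ := hR₀
  refine ⟨hR₀star, hSsmooth, hm, fun R t hR ↦ ?_, fun ε hε ↦ ?_⟩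
  · obtain ⟨hadm, hSE, hSG⟩ := hS R t hR
    obtain ⟨-, -, hmass, hexact⟩ := hGmem R hR
    refine ⟨hadm, hSE, fun t' x hx ↦ ?_, hmass, fun x hx ↦ ?_⟩
    · -- `t`-independence on `e.far R₀`: both are `G R` there
      obtain ⟨h1, h2⟩ := hSG x hx
      obtain ⟨h1', h2'⟩ := (hS R t' hR).2.2 x hx
      exact ⟨h1.trans h1'.symm, h2.trans h2'.symm⟩
    · -- the exact Schwarzschild zone is read beyond `32R > R₀`
      have hx' : R₀ < ‖x‖ := by
        have : R₀ < R := hR₀star.trans hR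
        have hRpos : 0 < R := lt_of_lt_of_le (e.R_pos.trans heR₀) this.le |>.trans_le le_rfl
        nlinarith
      obtain ⟨hh, hk⟩ := hCoeff_kCoeff_congr_of_agree_far e heR₀ hSG hx'
      rw [hh, hk]
      exact hexact x hx
  · obtain ⟨R₁, hR₁⟩ := hsob ε hε
    refine ⟨R₁, fun R t lam hR hR₁R hRlam ↦ ?_⟩
    have hSG := (hS R t hR).2.2
    rw [sobDev_congr_of_agree_far e heR₀ hSG ((hR₀star.trans hR).le.trans hRlam)]
    exact hR₁ R lam hR hR₁R hRlam

/-- **Glue B.** The LANDED patching engine `stub_probePatch` (p116096) gives a remote surgery over any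
interior probe and far-gluing family of the same datum along the same sole end. [folklore] -/
theorem exists_isRemoteSurgery {X : Type} [TopologicalSpace X] [ChartedSpace E3 X]
    [IsManifold (𝓡 3) ∞ X] [T2Space X] [SecondCountableTopology X] [ConnectedSpace X]
    (d : InitialDataSet (𝓡 3) X) (e : AFEnd X) (M₀ R₀ : ℝ) (E : ℝ → InitialDataSet (𝓡 3) X)
    (Rstar : ℝ) (m : ℝ → ℝ) (G : ℝ → InitialDataSet (𝓡 3) X) (hsole : e.IsSoleEnd)
    (hprobe : IsInteriorProbe d e R₀ E) (hG : IsFarGluingFamily d e M₀ R₀ Rstar m G) :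
    ∃ S : ℝ × ℝ → InitialDataSet (𝓡 3) X, IsRemoteSurgery d e M₀ R₀ E Rstar m S := by
  obtain ⟨hR₀, hEsmooth, -, hEadm, hEd⟩ := id hprobe
  obtain ⟨hR₀star, hGsmooth, -, hGmem, -⟩ := id hG
  obtain ⟨S, hSsmooth, hS⟩ := stub_probePatch X d e R₀ Rstar E G hsole hR₀ hR₀star hEsmooth hEadm hEd hGsmooth
    fun R hR ↦ ⟨(hGmem R hR).1, (hGmem R hR).2.1⟩
  exact ⟨S, isRemoteSurgery_of_patch hprobe hG hSsmooth hS⟩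

end PatchGlue

/-! ## §2 The reduction -/

/-- **THE REDUCTION of the crux by far-field surgery.**  `StarvedNecks.HonestFixedRadiusSettling` follows from
(A) FAR GLUING — a far-gluing family of every admissible datum along every sole Dafermos–Rodnianski end
beyond every radius (Mao–Oh–Tao arXiv:2308.13031 Thm 1.7/1.10 at scale `R`, with `C^∞`-dependence on
`R`) — and (D′) STABLE UNFOLDING WITH ONE ATLAS — through every admissible datum an interior probe along
which every sufficiently remote surgery member lies in `Negative.coreSet` (MGHD exists; every MGHD carries an
honest `C⁴` fixed-radius decomposition with one atlas at infinity — the final-state core on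
Schwarzschild-ended data).  Proof: for an exceptional admissible `d`, D′ gives end, probe and marker; A the
far-gluing family; the landed patching engine the surgery `S` (`exists_isRemoteSurgery`); D′ the threshold;
the landed threshold-junction lemma (`stub_thresholdJunction`) the typed smooth injective curve through `d`
above it, whose members are admissible and, for `c ≠ 0`, in `coreSet ⊆ settlingSet` (CERT) —
Christodoulou codimension `1` (`Negative.crux_iff`). Christodoulou, CQG 16 (1999) A23, p. A24. [folklore] -/
theorem honestFixedRadiusSettling_of_surgery :
    (∀ (X : Type) [TopologicalSpace X] [ChartedSpace E3 X] [IsManifold (𝓡 3) ∞ X] [T2Space X]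
      [SecondCountableTopology X] [ConnectedSpace X], ∀ d ∈ admissibleVacuumData X,
      ∀ (e : AFEnd X) (M₀ R₀ : ℝ), e.IsSoleEnd → e.IsStronglyAsymptoticallyFlatDR d M₀ → e.R < R₀ →
        ∃ (Rstar : ℝ) (m : ℝ → ℝ) (G : ℝ → InitialDataSet (𝓡 3) X), IsFarGluingFamily d e M₀ R₀ Rstar m G) →
    (∀ (X : Type) [TopologicalSpace X] [ChartedSpace E3 X] [IsManifold (𝓡 3) ∞ X] [T2Space X]
      [SecondCountableTopology X] [ConnectedSpace X], ∀ d ∈ admissibleVacuumData X,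
      ∃ (e : AFEnd X) (M₀ R₀ : ℝ) (E : ℝ → InitialDataSet (𝓡 3) X) (x₀ : X)
        (v₀ : TangentSpace (𝓡 3) x₀),
        e.IsSoleEnd ∧ e.IsStronglyAsymptoticallyFlatDR d M₀ ∧ IsInteriorProbe d e R₀ E ∧
          x₀ ∉ e.far R₀ ∧ Set.InjOn (fun t : ℝ ↦ (E t).h.inner x₀ v₀ v₀) (Set.Ioo (-1) 1) ∧
          ∀ (Rstar : ℝ) (m : ℝ → ℝ) (S : ℝ × ℝ → InitialDataSet (𝓡 3) X),
            IsRemoteSurgery d e M₀ R₀ E Rstar m S →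
              ∃ ρ : ℝ → ℝ, ContinuousOn ρ {t : ℝ | t ≠ 0} ∧
                ∀ R t : ℝ, Rstar < R → ρ t ≤ R → t ≠ 0 → |t| < 1 → S (R, t) ∈ coreSet X) →
    HonestFixedRadiusSettling := by
  intro hA hD
  rw [HonestFixedRadiusSettling.Negative.crux_iff]
  intro X _ _ _ _ _ _ d hd
  obtain ⟨hdadm, -⟩ := hd
  obtain ⟨e, M₀, R₀, E, x₀, v₀, hsole, hSAF, hprobe, hx₀, hmark, hrob⟩ := hD X d hdadm
  obtain ⟨Rstar, m, G, hG⟩ := hA X d hdadm e M₀ R₀ hsole hSAF hprobe.1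
  obtain ⟨S, hS⟩ := exists_isRemoteSurgery d e M₀ R₀ E Rstar m G hsole hprobe hG
  obtain ⟨ρ, hρ, hgood⟩ := hrob Rstar m S hS
  obtain ⟨hR₀, hSsmooth, -, hSmem, -⟩ := hS
  obtain ⟨-, hEsmooth, hE0, -, -⟩ := hprobe
  obtain ⟨F, hF, hF0, hinj, hmem⟩ :=
    stub_thresholdJunction X d e Rstar S E x₀ v₀ ρ hSsmooth hEsmooth hE0
      (fun R t hR x hx ↦ (hSmem R t hR).2.1 x hx) (not_mem_far_of_le e hR₀.le hx₀) hmark hρ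
  refine ⟨F, hF, hF0, hinj, fun c ↦ ?_, fun c hc hcE ↦ ?_⟩
  · by_cases hc : c = 0
    · subst hc
      rw [hF0]
      exact hdadm
    · obtain ⟨R, t, hR, -, -, -, hFc⟩ := hmem c hc
      rw [hFc]
      exact (hSmem R t hR).1
  · obtain ⟨R, t, hR, hρR, ht, ht1, hFc⟩ := hmem c hc
    have hgoodc : F c ∈ settlingSet X := by
      rw [hFc]
      exact coreSet_subset_settlingSet (hgood R t hR hρR ht ht1)
    exact hcE.2 hgoodc

end Summit.FinalStateConjecture.FinalStateConjecture.Theorems.StarvedNecks.FarFieldSurgery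

end
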